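import Summits.ResolutionOfSingularities.ResolutionOfSingularities.Theorems.FrobeniusLadderFRationalResolutionATwoChartSlots
import Summits.ResolutionOfSingularities.ResolutionOfSingularities.Theorems.FrobeniusLadderFRationalResolutionClassZModWeights
import HarnessLib

/-!
# Crux `FrobeniusLadder.FRationalResolution` (stmt-ResolutionOfSingularities-15317), line `redirect`,
# stub `stub_diagonalizableQuotientResolution` — A GENUINE TWO-STEP CLASS: `1/5(1,4)` (`A₄`; blow up the point, then the `A₂` point)

The weight kernel `P = {m ∈ ℕ² : 5 ∣ m₀ + 4 m₁}` (`A₄`, wild in characteristic `5`): Hilbert basis `G = {(5,0),(1,1),(0,5)}`, all vertices;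
the vertex charts at `(5,0)`, `(0,5)` are free, the chart at `(1,1)` is the `A₂` CONE `⟨(3,0),(1,1),(0,3)⟩` with the rational cone map
`ι = L/3`, `L = (4 −1; −1 4)` (`…ConeHomOfMatrix`), whose faces and (non-Veronese) vertex certificate are `…ATwoChartSlots.aTwo_chartSlots`
(p844083): the point blow-up of `A₄` has one singular point, an `A₂`, whose point blow-up is regular — the naive two-step recipe with a
singular intermediate step certified by `…VertexCertificateOfCharts`.

* `middleChart_oneFifth` — the cone data of the `A₂` chart at `(1,1)`;
* ★★★★ `hasResolution_of_isolated_fixedPoints_oneFifth`, ★★★★ `hasResolution_of_isolated_fixedPoints_zmod5` (`A = ℤ/5`, `a = (1,4)`).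

Honest label: a TOY surface instance exercising the full two-step pipeline; no stub, crux or summit closed. No definitions, no named
facts, no sorry. [folklore; cite: CoxLittleSchenck2011, §10.1] [cite: Kato1994, Thm. (3.2)]
-/

noncomputable section

-- single-problem summit: the doubled namespace component is forced
set_option linter.dupNamespace false

open CategoryTheory AlgebraicGeometry TopologicalSpace IsLocalRing
open Literature.AlgebraicGeometry.Resolution

namespace Summit.ResolutionOfSingularities.ResolutionOfSingularities.Theorems.FRationalResolution.ClassOneFifthOneFour

open ClassOneThirdOneTwo ClassOneFourthOneThree VeroneseTwoChart ATwoChart ConeCertificateGenerators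

/-- The exponent of `p ∈ ℕⁿ` in `ℤⁿ`. -/
local notation3 (prettyPrint := false) "toZ[" n "]" =>
  (Finsupp.mapRange.addMonoidHom (Nat.castAddMonoidHom ℤ) : (Fin n →₀ ℕ) →+ (Fin n →₀ ℤ))

/-- The generators of the `A₂` cone. -/
local notation3 (prettyPrint := false) "GA2" =>
  ({Finsupp.single 0 3, Finsupp.single 0 1 + Finsupp.single 1 1, Finsupp.single 1 3} : Set (Fin 2 →₀ ℕ))

/-- The `A₂` cone monoid. -/
local notation3 (prettyPrint := false) "QA2" =>
  AddSubmonoid.closure ({Finsupp.single 0 3, Finsupp.single 0 1 + Finsupp.single 1 1, Finsupp.single 1 3} : Set (Fin 2 →₀ ℕ))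

/-! ## §1 The `A₂` chart of `1/5(1,4)` at the vertex `(1,1)` -/

/-- **The cone data of the vertex chart of `P = {5 ∣ m₀ + 4m₁}` at `(1,1)`**: `Q = QA2`, `ι = L/3`, `L = (4 −1; −1 4)`, second disjunct
from `aTwo_chartSlots`. [folklore; cite: CoxLittleSchenck2011, §10.1] -/
theorem middleChart_oneFifth (P : AddSubmonoid (Fin 2 →₀ ℕ)) (hcls : ∀ m : Fin 2 →₀ ℕ, m ∈ P ↔ 5 ∣ m 0 + 4 * m 1)
    (hGP : AddSubmonoid.closure ({Finsupp.single 0 5, Finsupp.single 0 1 + Finsupp.single 1 1, Finsupp.single 1 5} :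
      Set (Fin 2 →₀ ℕ)) = P)
    (v : ↥P) (hv : (v : Fin 2 →₀ ℕ) = Finsupp.single 0 1 + Finsupp.single 1 1) :
    ∃ (n' : ℕ) (Q : AddSubmonoid (Fin n' →₀ ℕ)) (ι : ↥Q →+ (Fin 2 →₀ ℤ)) (_ : Function.Injective ι)
      (_ : ∀ e : ↥P, e ≠ 0 → ∃ u : ↥Q, ι u = toZ[2] (e : Fin 2 →₀ ℕ) - toZ[2] (v : Fin 2 →₀ ℕ))
      (_ : ∀ p : ↥P, ∃ u : ↥Q, ι u = toZ[2] (p : Fin 2 →₀ ℕ))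
      (_ : ∀ u : ↥Q, ∃ (p : ↥P) (r : ℕ) (e : Fin r → ↥P), (∀ i, e i ≠ 0) ∧
        ι u = toZ[2] (p : Fin 2 →₀ ℕ) + ∑ i, (toZ[2] ((e i : ↥P) : Fin 2 →₀ ℕ) - toZ[2] (v : Fin 2 →₀ ℕ))),
      (∀ (κ : Type) [Field κ], IsRegularRing (AddMonoidAlgebra κ ↥Q)) ∨
      ∃ (GQ : Set (Fin n' →₀ ℕ)) (_ : GQ.Finite) (_ : (0 : Fin n' →₀ ℕ) ∉ GQ) (_ : AddSubmonoid.closure GQ = Q),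
        (∀ (κ : Type) [Field κ], ∀ u : ↥Q, (u : Fin n' →₀ ℕ) ∈ GQ →
          IsRegularRing (Localization.Away (AddMonoidAlgebra.single u (1 : κ)))) ∧
        (∀ (K : Type) [Field K], Scheme.IsRegular (affineBlowup (Ideal.span {w : ↥(Algebra.adjoin K
          ((fun d : Fin n' →₀ ℕ => MvPolynomial.monomial d (1 : K)) '' GQ)) |
          ∃ d ∈ GQ, (w : MvPolynomial (Fin n') K) = MvPolynomial.monomial d 1}))) := by
  have hg0P : (Finsupp.single 0 5 : Fin 2 →₀ ℕ) ∈ P := (hcls _).2 (by simp)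
  have hg2P : (Finsupp.single 1 5 : Fin 2 →₀ ℕ) ∈ P := (hcls _).2 (by simp)
  have hne0 : (⟨Finsupp.single 0 5, hg0P⟩ : ↥P) ≠ 0 := fun h => by
    have := DFunLike.congr_fun (congrArg Subtype.val h) 0; simp at this
  have hne2 : (⟨Finsupp.single 1 5, hg2P⟩ : ↥P) ≠ 0 := fun h => by
    have := DFunLike.congr_fun (congrArg Subtype.val h) 1; simp at this
  -- the generators of `QA2` as members, and sums of them
  have m0 : (Finsupp.single 0 3 : Fin 2 →₀ ℕ) ∈ QA2 := AddSubmonoid.subset_closure (Or.inl rfl)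
  have m1 : (Finsupp.single 0 1 + Finsupp.single 1 1 : Fin 2 →₀ ℕ) ∈ QA2 := AddSubmonoid.subset_closure (Or.inr (Or.inl rfl))
  have m2 : (Finsupp.single 1 3 : Fin 2 →₀ ℕ) ∈ QA2 := AddSubmonoid.subset_closure (Or.inr (Or.inr rfl))
  -- the integer matrix `L = (4 −1; −1 4)` and its third `ι`
  obtain ⟨L, hLM⟩ := exists_matrixHom (n := 2) (n' := 2) ![![4, -1], ![-1, 4]]
  have hL0 : ∀ u : Fin 2 →₀ ℕ, L u 0 = 4 * (u 0 : ℤ) + (-1) * (u 1 : ℤ) := fun u => by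
    rw [hLM, Fin.sum_univ_two]; simp; ring
  have hL1 : ∀ u : Fin 2 →₀ ℕ, L u 1 = (-1) * (u 0 : ℤ) + 4 * (u 1 : ℤ) := fun u => by
    rw [hLM, Fin.sum_univ_two]; simp; ring
  have hLinj : Function.Injective L := matrixHom_injective_two L 4 (-1) (-1) 4 hL0 hL1 (by norm_num)
  have hdvd : ∀ u : ↥QA2, ∀ i, (3 : ℤ) ∣ L (u : Fin 2 →₀ ℕ) i := by
    refine forall_dvd_of_generators QA2 L 3 GA2 rfl fun g hg i => ?_
    rcases hg with rfl | rfl | rfl <;> fin_cases i <;>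
      simp only [Fin.zero_eta, Fin.mk_one, Fin.isValue, hL0, hL1] <;> norm_num
  obtain ⟨ι, hι⟩ := exists_hom_of_dvd QA2 L 3 hdvd
  have hιinj : Function.Injective ι :=
    hom_injective QA2 L 3 ι hι fun u w h => Subtype.ext (hLinj h)
  have heq : ∀ (u : ↥QA2) (z : Fin 2 →₀ ℤ), L (u : Fin 2 →₀ ℕ) 0 = 3 * z 0 → L (u : Fin 2 →₀ ℕ) 1 = 3 * z 1 → ι u = z :=
    fun u z h0 h1 => (hom_apply_eq_iff QA2 L 3 (by norm_num) ι hι u z).2 fun i => by fin_cases i; exacts [h0, h1]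
  have hvZ : toZ[2] (v : Fin 2 →₀ ℕ) = Finsupp.single 0 1 + Finsupp.single 1 1 := by rw [hv, map_add]; simp
  -- (hPQ) on the generators of `P`: `(5,0) = ι(4,1)`, `(1,1) = ι(1,1)`, `(0,5) = ι(1,4)`
  have hG1 : ∀ g ∈ ({Finsupp.single 0 5, Finsupp.single 0 1 + Finsupp.single 1 1, Finsupp.single 1 5} : Set (Fin 2 →₀ ℕ)),
      ∃ u : ↥QA2, ι u = toZ[2] g := by
    rintro g (rfl | rfl | rfl)
    · refine ⟨⟨Finsupp.single 0 3 + (Finsupp.single 0 1 + Finsupp.single 1 1), add_mem m0 m1⟩, heq _ _ ?_ ?_⟩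
      · rw [hL0]; simp
      · rw [hL1]; simp
    · exact ⟨⟨_, m1⟩, heq _ _ (by rw [hL0]; simp) (by rw [hL1]; simp)⟩
    · refine ⟨⟨(Finsupp.single 0 1 + Finsupp.single 1 1) + Finsupp.single 1 3, add_mem m1 m2⟩, heq _ _ ?_ ?_⟩
      · rw [hL0]; simp
      · rw [hL1]; simp
  have hPQ := forall_exists_eq_of_generators P QA2 ι (toZ[2]) _ hGP hG1
  -- (hE) on the generators of `P`: `(4,−1) = ι(3,0)`, `0`, `(−1,4) = ι(0,3)`
  have hG2 : ∀ g ∈ ({Finsupp.single 0 5, Finsupp.single 0 1 + Finsupp.single 1 1, Finsupp.single 1 5} : Set (Fin 2 →₀ ℕ)),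
      ∃ u : ↥QA2, ι u = toZ[2] g - toZ[2] (v : Fin 2 →₀ ℕ) := by
    rintro g (rfl | rfl | rfl)
    · exact ⟨⟨_, m0⟩, heq _ _ (by rw [hL0, hvZ]; simp) (by rw [hL1, hvZ]; simp)⟩
    · exact ⟨0, by rw [map_zero, hv, sub_self]⟩
    · exact ⟨⟨_, m2⟩, heq _ _ (by rw [hL0, hvZ]; simp) (by rw [hL1, hvZ]; simp)⟩
  have hE := forall_exists_eq_sub_of_generators P QA2 ι (toZ[2]) _ hGP _ hG2 hPQ
  -- (hQ) on the generators of `QA2`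
  have hG3 : ∀ u : ↥QA2, (u : Fin 2 →₀ ℕ) ∈ GA2 → ∃ (p : ↥P) (r : ℕ) (e : Fin r → ↥P), (∀ i, e i ≠ 0) ∧
      ι u = toZ[2] (p : Fin 2 →₀ ℕ) + ∑ i, (toZ[2] ((e i : ↥P) : Fin 2 →₀ ℕ) - toZ[2] (v : Fin 2 →₀ ℕ)) := by
    intro u hu
    rcases hu with h | h | h
    · refine ⟨0, 1, ![⟨Finsupp.single 0 5, hg0P⟩], fun i => by fin_cases i; exact hne0, ?_⟩
      refine heq u _ ?_ ?_
      · rw [hL0, h, Fin.sum_univ_one, hvZ]; simp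
      · rw [hL1, h, Fin.sum_univ_one, hvZ]; simp
    · refine ⟨v, 0, Fin.elim0, fun i => i.elim0, ?_⟩
      refine heq u _ ?_ ?_
      · rw [hL0, h, Finset.univ_eq_empty, Finset.sum_empty, add_zero, hvZ]; simp
      · rw [hL1, h, Finset.univ_eq_empty, Finset.sum_empty, add_zero, hvZ]; simp
    · refine ⟨0, 1, ![⟨Finsupp.single 1 5, hg2P⟩], fun i => by fin_cases i; exact hne2, ?_⟩
      refine heq u _ ?_ ?_
      · rw [hL0, h, Fin.sum_univ_one, hvZ]; simp
      · rw [hL1, h, Fin.sum_univ_one, hvZ]; simp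
  have hQ := forall_exists_decomp_of_generators P QA2 ι (toZ[2]) (toZ[2] (v : Fin 2 →₀ ℕ)) GA2 rfl hG3
  obtain ⟨hfin, h0, hface, hvert⟩ := aTwo_chartSlots
  exact ⟨2, QA2, ι, hιinj, hE, hPQ, hQ, Or.inr ⟨GA2, hfin, h0, rfl, hface, hvert⟩⟩

/-! ## §2 The class `1/5(1,4)` -/

/-- ★★★★ **RESOLUTION OF VARIETIES WHOSE SINGULAR POINTS ARE ISOLATED FIXED POINTS OF TYPE `1/5(1,4)`** (`A₄`; any characteristic).
[folklore; cite: CoxLittleSchenck2011, §10.1] [cite: Kato1994, Thm. (3.2)] -/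
theorem hasResolution_of_isolated_fixedPoints_oneFifth (k : Type) [Field k] (X : Scheme.{0}) [IsIntegral X]
    (f : X ⟶ Spec (.of k)) [LocallyOfFiniteType f] (hfin : (Scheme.regularLocus X)ᶜ.Finite)
    (hchart : ∀ t : X, t ∉ Scheme.regularLocus X →
      ∃ (k' : Type) (_ : Field k') (A : Type) (_ : DecidableEq A) (_ : AddCommGroup A) (_ : AddMonoid.IsTorsion A)
        (S : Type) (_ : CommRing S) (_ : Algebra k' S) (𝒮 : A → Submodule k' S) (_ : GradedAlgebra 𝒮)
        (_ : Algebra.FiniteType k' S) (φ : Spec (.of (𝒮 0)) ⟶ X) (_ : Etale φ)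
        (𝔔 : Ideal S) (_ : 𝔔.IsPrime) (_ : ∀ a : A, a ≠ 0 → ∀ s ∈ 𝒮 a, s ∈ 𝔔)
        (x : Fin 2 → S) (a : Fin 2 → A) (P : AddSubmonoid (Fin 2 →₀ ℕ))
        (_ : ∀ i, x i ∈ 𝔔 ∧ x i ∈ 𝒮 (a i))
        (_ : Ideal.span (algebraMap S (Localization.AtPrime 𝔔) '' Set.range x) = maximalIdeal (Localization.AtPrime 𝔔))
        (_ : ((2 : ℕ) : WithBot ℕ∞) = ringKrullDim (Localization.AtPrime 𝔔))
        (_ : ∀ m, m ∈ P ↔ Finsupp.weight a m = 0)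
        (_ : ∀ m : Fin 2 →₀ ℕ, m ∈ P ↔ 5 ∣ m 0 + 4 * m 1),
        φ ⟨𝔔.comap (algebraMap (𝒮 0) S), inferInstance⟩ = t) :
    Scheme.HasResolution X := by
  refine MonoidAlgebraLaurent.hasResolution_of_isolated_fixedPoints_of_mixedConeCertificate k X f hfin fun t ht => ?_
  have hc := hchart t ht
  obtain ⟨k', ik, A, iA₁, iA₂, hA, S, iS₁, iS₂, 𝒮, i𝒮, iS₃, φ, iφ, 𝔔, i𝔔, hfix, x, a, P, hxa, hspan, hn, hP, hcls, hφt⟩ := hc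
  have hg0P : (Finsupp.single 0 5 : Fin 2 →₀ ℕ) ∈ P := (hcls _).2 (by simp)
  have hg1P : (Finsupp.single 0 1 + Finsupp.single 1 1 : Fin 2 →₀ ℕ) ∈ P := (hcls _).2 (by simp)
  have hg2P : (Finsupp.single 1 5 : Fin 2 →₀ ℕ) ∈ P := (hcls _).2 (by simp)
  let G : Set (Fin 2 →₀ ℕ) := {Finsupp.single 0 5, Finsupp.single 0 1 + Finsupp.single 1 1, Finsupp.single 1 5}
  have hGfin : G.Finite := ((Set.finite_singleton _).insert _).insert _
  have hGP' : G ⊆ P := by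
    rintro g (rfl | rfl | rfl)
    exacts [hg0P, hg1P, hg2P]
  have hG0 : (0 : Fin 2 →₀ ℕ) ∉ G := by
    rintro (h | h | h)
    · have := DFunLike.congr_fun h 0; simp at this
    · have := DFunLike.congr_fun h 0; simp at this
    · have := DFunLike.congr_fun h 1; simp at this
  have hGP : AddSubmonoid.closure G = P := by
    refine WeightKernelBasis.closure_eq_of_box P G hGP' ?_ 5 (by norm_num) ?_ ?_
    · intro m hm g hg hgm
      have hm' := (hcls m).1 hm
      have hg' := (hcls g).1 hg
      have h0 := Finsupp.le_def.1 hgm 0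
      have h1 := Finsupp.le_def.1 hgm 1
      refine (hcls _).2 ?_
      simp only [Finsupp.tsub_apply]
      omega
    · intro i
      fin_cases i
      · exact Or.inl rfl
      · exact Or.inr (Or.inr rfl)
    · intro m hm hm0 hlt
      have hm' := (hcls m).1 hm
      have h0 := hlt 0
      have h1 := hlt 1
      have hne : m 0 ≠ 0 ∨ m 1 ≠ 0 := by
        by_contra h
        push Not at h
        exact hm0 (by ext i; fin_cases i <;> simp [h.1, h.2])
      refine ⟨Finsupp.single 0 1 + Finsupp.single 1 1, Or.inr (Or.inl rfl), ?_, ?_⟩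
      · intro h
        have := DFunLike.congr_fun h 0
        simp at this
      · refine Finsupp.le_def.2 fun i => ?_
        fin_cases i
        · simp; omega
        · simp; omega
  let gen : Fin 3 → ↥P := ![⟨Finsupp.single 0 5, hg0P⟩, ⟨Finsupp.single 0 1 + Finsupp.single 1 1, hg1P⟩, ⟨Finsupp.single 1 5, hg2P⟩]
  have hgen0 : ((gen 0 : ↥P) : Fin 2 →₀ ℕ) = Finsupp.single 0 5 := rfl
  have hgen1 : ((gen 1 : ↥P) : Fin 2 →₀ ℕ) = Finsupp.single 0 1 + Finsupp.single 1 1 := rfl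
  have hgen2 : ((gen 2 : ↥P) : Fin 2 →₀ ℕ) = Finsupp.single 1 5 := rfl
  have hgenG : ∀ i, ((gen i : ↥P) : Fin 2 →₀ ℕ) ∈ G := by
    intro i
    fin_cases i
    · exact Or.inl hgen0
    · exact Or.inr (Or.inl hgen1)
    · exact Or.inr (Or.inr hgen2)
  have hGgen : ∀ g ∈ G, ∃ i, ((gen i : ↥P) : Fin 2 →₀ ℕ) = g := by
    rintro g (rfl | rfl | rfl)
    exacts [⟨0, hgen0⟩, ⟨1, hgen1⟩, ⟨2, hgen2⟩]
  have hv0 : ∀ j, gen j ≠ 0 := by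
    intro j h
    have h' : ((gen j : ↥P) : Fin 2 →₀ ℕ) = 0 := by rw [h]; rfl
    exact hG0 (h' ▸ hgenG j)
  refine ⟨k', ik, A, iA₁, iA₂, hA, S, iS₁, iS₂, 𝒮, i𝒮, iS₃, φ, iφ, 𝔔, i𝔔, hfix, 2, x, a, P, hxa, hspan, hn, hP, G, hGfin, hG0, hGP,
    hφt, 3, gen, hgenG, hGgen, 3, gen, hv0, 1, le_rfl, id, fun _ => 0, fun _ => le_rfl, fun _ => Fin.elim0,
    fun _ l => l.elim0, fun i => by simp, fun j => ?_⟩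
  have mem : ∀ w : Fin 2 →₀ ℕ, w ∈ (⊤ : AddSubmonoid (Fin 2 →₀ ℕ)) := fun w => AddSubmonoid.mem_top w
  fin_cases j
  · -- vertex `(5,0)`: free chart cone generated by `(5,0), (−4,1)`
    refine freeChart_of_matrix P G hGP (gen 0) 5 (-4) 0 1 (by norm_num) fun ι hι => ⟨?_, ?_, ?_⟩
    · rintro g (rfl | rfl | rfl)
      · exact ⟨⟨Finsupp.single 0 1, mem _⟩, coneHom_eq ι hι _ _ (by simp) (by simp)⟩
      · exact ⟨⟨Finsupp.single 0 1 + Finsupp.single 1 1, mem _⟩, coneHom_eq ι hι _ _ (by simp) (by simp)⟩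
      · exact ⟨⟨Finsupp.single 0 4 + Finsupp.single 1 5, mem _⟩, coneHom_eq ι hι _ _ (by simp) (by simp)⟩
    · rintro g (rfl | rfl | rfl)
      · exact ⟨0, by rw [map_zero, hgen0, sub_self]⟩
      · exact ⟨⟨Finsupp.single 1 1, mem _⟩, coneHom_eq ι hι _ _ (by simp [hgen0]) (by simp [hgen0])⟩
      · exact ⟨⟨Finsupp.single 0 3 + Finsupp.single 1 5, mem _⟩, coneHom_eq ι hι _ _ (by simp [hgen0]) (by simp [hgen0])⟩
    · rintro u ⟨i, hi⟩
      fin_cases i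
      · refine ⟨gen 0, 0, Fin.elim0, fun i => i.elim0, ?_⟩
        rw [Finset.univ_eq_empty, Finset.sum_empty, add_zero]
        exact coneHom_eq ι hι _ _ (by simp [← hi, hgen0]) (by simp [← hi, hgen0])
      · refine ⟨0, 1, ![gen 1], fun i => by fin_cases i; exact hv0 1, ?_⟩
        rw [Fin.sum_univ_one]
        exact coneHom_eq ι hι _ _ (by simp [← hi, hgen0, hgen1]) (by simp [← hi, hgen0, hgen1])
  · -- vertex `(1,1)`: the `A₂` chart
    exact middleChart_oneFifth P hcls hGP (gen 1) hgen1
  · -- vertex `(0,5)`: free chart cone generated by `(1,−4), (0,5)`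
    refine freeChart_of_matrix P G hGP (gen 2) 1 0 (-4) 5 (by norm_num) fun ι hι => ⟨?_, ?_, ?_⟩
    · rintro g (rfl | rfl | rfl)
      · exact ⟨⟨Finsupp.single 0 5 + Finsupp.single 1 4, mem _⟩, coneHom_eq ι hι _ _ (by simp) (by simp)⟩
      · exact ⟨⟨Finsupp.single 0 1 + Finsupp.single 1 1, mem _⟩, coneHom_eq ι hι _ _ (by simp) (by simp)⟩
      · exact ⟨⟨Finsupp.single 1 1, mem _⟩, coneHom_eq ι hι _ _ (by simp) (by simp)⟩
    · rintro g (rfl | rfl | rfl)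
      · exact ⟨⟨Finsupp.single 0 5 + Finsupp.single 1 3, mem _⟩, coneHom_eq ι hι _ _ (by simp [hgen2]) (by simp [hgen2])⟩
      · exact ⟨⟨Finsupp.single 0 1, mem _⟩, coneHom_eq ι hι _ _ (by simp [hgen2]) (by simp [hgen2])⟩
      · exact ⟨0, by rw [map_zero, hgen2, sub_self]⟩
    · rintro u ⟨i, hi⟩
      fin_cases i
      · refine ⟨0, 1, ![gen 1], fun i => by fin_cases i; exact hv0 1, ?_⟩
        rw [Fin.sum_univ_one]
        exact coneHom_eq ι hι _ _ (by simp [← hi, hgen1, hgen2]) (by simp [← hi, hgen1, hgen2])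
      · refine ⟨gen 2, 0, Fin.elim0, fun i => i.elim0, ?_⟩
        rw [Finset.univ_eq_empty, Finset.sum_empty, add_zero]
        exact coneHom_eq ι hι _ _ (by simp [← hi, hgen2]) (by simp [← hi, hgen2])

/-- ★★★★ **`A = ℤ/5`, weights `(1,4)`**: the same with the single honest hypothesis `m ∈ P ↔ m₀ • 1 + m₁ • 4 = 0 in ℤ/5`.
[folklore; cite: CoxLittleSchenck2011, §10.1] [cite: Kato1994, Thm. (3.2)] -/
theorem hasResolution_of_isolated_fixedPoints_zmod5 (k : Type) [Field k] (X : Scheme.{0}) [IsIntegral X]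
    (f : X ⟶ Spec (.of k)) [LocallyOfFiniteType f] (hfin : (Scheme.regularLocus X)ᶜ.Finite)
    (hchart : ∀ t : X, t ∉ Scheme.regularLocus X →
      ∃ (k' : Type) (_ : Field k')
        (S : Type) (_ : CommRing S) (_ : Algebra k' S) (𝒮 : ZMod 5 → Submodule k' S) (_ : GradedAlgebra 𝒮)
        (_ : Algebra.FiniteType k' S) (φ : Spec (.of (𝒮 0)) ⟶ X) (_ : Etale φ)
        (𝔔 : Ideal S) (_ : 𝔔.IsPrime) (_ : ∀ a : ZMod 5, a ≠ 0 → ∀ s ∈ 𝒮 a, s ∈ 𝔔)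
        (x : Fin 2 → S) (P : AddSubmonoid (Fin 2 →₀ ℕ))
        (_ : ∀ i, x i ∈ 𝔔 ∧ x i ∈ 𝒮 (![(1 : ZMod 5), ((4 : ℕ) : ZMod 5)] i))
        (_ : Ideal.span (algebraMap S (Localization.AtPrime 𝔔) '' Set.range x) = maximalIdeal (Localization.AtPrime 𝔔))
        (_ : ((2 : ℕ) : WithBot ℕ∞) = ringKrullDim (Localization.AtPrime 𝔔))
        (_ : ∀ m, m ∈ P ↔ Finsupp.weight (![(1 : ZMod 5), ((4 : ℕ) : ZMod 5)]) m = 0),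
        φ ⟨𝔔.comap (algebraMap (𝒮 0) S), inferInstance⟩ = t) :
    Scheme.HasResolution X := by
  refine hasResolution_of_isolated_fixedPoints_oneFifth k X f hfin fun t ht => ?_
  have hc := hchart t ht
  obtain ⟨k', ik, S, iS₁, iS₂, 𝒮, i𝒮, iS₃, φ, iφ, 𝔔, i𝔔, hfix, x, P, hxa, hspan, hn, hP, hφt⟩ := hc
  haveI : Fact (1 < 5) := ⟨by norm_num⟩
  exact ⟨k', ik, ZMod 5, inferInstance, inferInstance, is_add_torsion_of_finite (G := ZMod 5), S, iS₁, iS₂, 𝒮, i𝒮, iS₃, φ, iφ,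
    𝔔, i𝔔, hfix, x, ![(1 : ZMod 5), ((4 : ℕ) : ZMod 5)], P, hxa, hspan, hn, hP,
    fun m => (hP m).trans (ClassZModWeights.weight_zmod_eq_zero_iff 5 4 m), hφt⟩

end Summit.ResolutionOfSingularities.ResolutionOfSingularities.Theorems.FRationalResolution.ClassOneFifthOneFour

end
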